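import Mathlib
import Literature.Analysis.FunctionSpaces.PlancherelL1L2

/-!
# Band-limited functions: the sup norm is controlled by the `L²` norm (Bernstein–Nikolskii)

If `f ∈ L¹ ∩ L²(ℝ; ℂ)` is continuous and its Fourier transform (Mathlib's convention
`𝓕 f (ξ) = ∫ f(x) e^{-2πi xξ} dx`) vanishes outside `[-K, K]`, then for every `x`

  `‖f x‖ ≤ √(2K) · (∫ ‖f‖²)^{1/2}`.

Proof: Fourier inversion `f = 𝓕⁻ 𝓕 f` (the transform is continuous with compact support, hence integrable),
`‖f x‖ ≤ ∫_{[-K,K]} ‖𝓕 f‖`, Cauchy–Schwarz on the interval, and Plancherel `∫ ‖𝓕 f‖² = ∫ ‖f‖²`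
(`Literature.Analysis.FunctionSpaces.integral_norm_sq_fourierIntegral_eq`).  In angular-frequency terms
(support `|k| ≤ k₀ = 2πK`) the constant reads `√(k₀/π)`.  This is the one-dimensional band-limited case of the
Nikolskii inequality between `L^∞` and `L²` (Bernstein's inequality family for entire functions of exponential type).
[cite: TriebelTFS1983, §1.3.2 Remark 1 (Nikol'skij inequality for entire functions of exponential type)];
S. M. Nikol'skii, Trudy Mat. Inst. Steklov 38 (1951) 244–278.
-/

noncomputable section

open MeasureTheory Real Complex Set Filter
open scoped FourierTransform

namespace Literature.Analysis.Fourier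

/-- The Fourier transform of an integrable function which vanishes off `[-K, K]` is integrable (it is continuous
with compact support). [cite: TriebelTFS1983, §1.3.2] -/
theorem integrable_fourier_of_support_subset_Icc {f : ℝ → ℂ} (hf : Integrable f) {K : ℝ}
    (hsupp : ∀ ξ : ℝ, K < |ξ| → 𝓕 f ξ = 0) : Integrable (𝓕 f) := by
  have hcont : Continuous (𝓕 f) := Literature.Analysis.FunctionSpaces.continuous_fourierIntegral hf
  have hcs : HasCompactSupport (𝓕 f) := by
    refine HasCompactSupport.intro (isCompact_Icc : IsCompact (Icc (-K) K)) fun ξ hξ => hsupp ξ ?_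
    rw [mem_Icc, not_and_or, not_le, not_le] at hξ
    rcases hξ with h | h
    · exact lt_of_lt_of_le (by linarith) (neg_le_abs ξ)
    · exact lt_of_lt_of_le h (le_abs_self ξ)
  exact hcont.integrable_of_hasCompactSupport hcs

/-- **Band-limited sup bound (Bernstein–Nikolskii, `L² → L^∞`).**  For `f ∈ L¹ ∩ L²(ℝ; ℂ)` continuous with
`𝓕 f = 0` off `[-K, K]` (`K ≥ 0`): `‖f x‖ ≤ √(2K) · √(∫ ‖f‖²)` for every `x`. [cite: TriebelTFS1983, §1.3.2 Remark 1] -/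
theorem norm_le_sqrt_two_mul_of_fourier_support {f : ℝ → ℂ} (hf : Integrable f) (hf2 : MemLp f 2) (hfc : Continuous f)
    {K : ℝ} (hK : 0 ≤ K) (hsupp : ∀ ξ : ℝ, K < |ξ| → 𝓕 f ξ = 0) (x : ℝ) :
    ‖f x‖ ≤ Real.sqrt (2 * K) * Real.sqrt (∫ t : ℝ, ‖f t‖ ^ 2) := by
  have hF : Integrable (𝓕 f) := integrable_fourier_of_support_subset_Icc hf hsupp
  -- Fourier inversion at `x`
  have hinv : 𝓕⁻ (𝓕 f) x = f x := congrFun (hfc.fourierInv_fourier_eq hf hF) x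
  -- `‖f x‖ ≤ ∫ ‖𝓕 f‖`
  have h1 : ‖f x‖ ≤ ∫ ξ : ℝ, ‖𝓕 f ξ‖ := by
    rw [← hinv, Real.fourierInv_eq]
    refine (norm_integral_le_integral_norm _).trans (le_of_eq ?_)
    simp_rw [Circle.norm_smul]
  -- the integrand vanishes off `S = [-K, K]`
  set S : Set ℝ := Icc (-K) K with hS
  have hzero : ∀ ξ, ξ ∉ S → 𝓕 f ξ = 0 := by
    intro ξ hξ
    refine hsupp ξ ?_
    rw [hS, mem_Icc, not_and_or, not_le, not_le] at hξ
    rcases hξ with h | h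
    · exact lt_of_lt_of_le (by linarith) (neg_le_abs ξ)
    · exact lt_of_lt_of_le h (le_abs_self ξ)
  have h2 : ∫ ξ : ℝ, ‖𝓕 f ξ‖ = ∫ ξ in S, ‖𝓕 f ξ‖ :=
    (setIntegral_eq_integral_of_forall_compl_eq_zero fun ξ hξ => by rw [hzero ξ hξ, norm_zero]).symm
  have h3 : ∫ ξ in S, ‖𝓕 f ξ‖ ^ 2 = ∫ ξ : ℝ, ‖𝓕 f ξ‖ ^ 2 :=
    setIntegral_eq_integral_of_forall_compl_eq_zero fun ξ hξ => by rw [hzero ξ hξ, norm_zero]; simp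
  -- Cauchy–Schwarz on `S` (finite measure `2K`)
  haveI : IsFiniteMeasure (volume.restrict S) := by
    rw [isFiniteMeasure_restrict, hS, Real.volume_Icc]; exact ENNReal.ofReal_ne_top
  have hFm : MemLp (fun ξ => ‖𝓕 f ξ‖) (ENNReal.ofReal 2) (volume.restrict S) := by
    have h := (Literature.Analysis.FunctionSpaces.memLp_two_fourierIntegral hf hf2).restrict S
    rw [show ENNReal.ofReal 2 = 2 by norm_num]
    exact h.norm
  have h1m : MemLp (fun _ : ℝ => (1 : ℝ)) (ENNReal.ofReal 2) (volume.restrict S) := memLp_const 1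
  have hcs := integral_mul_le_Lp_mul_Lq_of_nonneg Real.HolderConjugate.two_two
    (Eventually.of_forall fun _ => zero_le_one) (Eventually.of_forall fun ξ => norm_nonneg (𝓕 f ξ)) h1m hFm
  simp only [Real.rpow_two, one_pow, one_mul] at hcs
  -- `∫_S 1 = 2K`
  have hvol : ∫ _ in S, (1 : ℝ) = 2 * K := by
    rw [setIntegral_const, smul_eq_mul, mul_one, Measure.real, hS, Real.volume_Icc, ENNReal.toReal_ofReal (by linarith)]
    ring
  rw [hvol, h3, Literature.Analysis.FunctionSpaces.integral_norm_sq_fourierIntegral_eq hf hf2] at hcs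
  calc ‖f x‖ ≤ ∫ ξ in S, ‖𝓕 f ξ‖ := h1.trans h2.le
    _ ≤ (2 * K) ^ (1 / (2 : ℝ)) * (∫ t : ℝ, ‖f t‖ ^ 2) ^ (1 / (2 : ℝ)) := hcs
    _ = Real.sqrt (2 * K) * Real.sqrt (∫ t : ℝ, ‖f t‖ ^ 2) := by
        rw [Real.sqrt_eq_rpow, Real.sqrt_eq_rpow]

/-- Squared form: `‖f x‖² ≤ 2K · ∫ ‖f‖²`. [cite: TriebelTFS1983, §1.3.2 Remark 1] -/
theorem norm_sq_le_two_mul_integral_of_fourier_support {f : ℝ → ℂ} (hf : Integrable f) (hf2 : MemLp f 2)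
    (hfc : Continuous f) {K : ℝ} (hK : 0 ≤ K) (hsupp : ∀ ξ : ℝ, K < |ξ| → 𝓕 f ξ = 0) (x : ℝ) :
    ‖f x‖ ^ 2 ≤ 2 * K * ∫ t : ℝ, ‖f t‖ ^ 2 := by
  have h := norm_le_sqrt_two_mul_of_fourier_support hf hf2 hfc hK hsupp x
  have hI : 0 ≤ ∫ t : ℝ, ‖f t‖ ^ 2 := integral_nonneg fun _ => by positivity
  calc ‖f x‖ ^ 2 ≤ (Real.sqrt (2 * K) * Real.sqrt (∫ t : ℝ, ‖f t‖ ^ 2)) ^ 2 :=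
        pow_le_pow_left₀ (norm_nonneg _) h 2
    _ = 2 * K * ∫ t : ℝ, ‖f t‖ ^ 2 := by
        rw [mul_pow, Real.sq_sqrt (by linarith), Real.sq_sqrt hI]

end Literature.Analysis.Fourier

end
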